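import Mathlib.MeasureTheory.Measure.Haar.Unique
import Literature.Probability.LatticeModels.GinibreInequality
import HarnessLib

/-!
# Ginibre's inequality, covariance form (Griffiths' second inequality for compact abelian models)

J. Ginibre, *General formulation of Griffiths' inequalities*, Comm. Math. Phys. 16 (1970)
310–328, Prop. 3 with Example 4: for a compact abelian group and a ferromagnetic Hamiltonian
`−H = ∑ₐ Jₐ Re χₐ`, `Jₐ ≥ 0`, the Gibbs state satisfies `⟨fg⟩ − ⟨f⟩⟨g⟩ ≥ 0` for `f, g` in the
cone generated by the real parts of characters.  The sibling file `GinibreInequality.lean` proves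
the MONOTONE corollary (`ginibreExpect_reChar_mono`: `⟨Re χ₀⟩_J` is non-decreasing in each
`Jₐ`); this file proves the COVARIANCE form for two characters by the same duplication argument:

* `ginibreCovIntegrand`, `ginibreCovTrunc` — the pull-back under the duplication map
  `(φ, ψ) ↦ (φψ, φψ⁻¹)` of `(f(θ) − f(θ'))(g(θ) − g(θ'))e^{H(θ)+H(θ')}` for `f = Re χ₀`, `g = Re χ₁`:
  `4 Im χ₀(φ)Im χ₀(ψ) · Im χ₁(φ)Im χ₁(ψ) · exp(2∑ Jₐ Re χₐ(φ)Re χₐ(ψ))` (`ginibre_cov_key`), a limit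
  of positive kernels (`integral_ginibreCovIntegrand_nonneg`);
* **`ginibreExpect_mul_reChar_ge`** — for `J ≥ 0` and continuous unitary characters `χ₀, χ₁` of a
  compact second-countable abelian group in which every element is a square (any torus `U(1)^E`):
  `⟨Re χ₀⟩_J · ⟨Re χ₁⟩_J ≤ ⟨Re χ₀ · Re χ₁⟩_J`.
For `U(1)` lattice gauge theory (`χₐ` = plaquette holonomies, `χ₀, χ₁` = any Wilson loops /
plaquettes / Polyakov loops) this is the non-negativity of every truncated two-loop correlation at
every `β ≥ 0`, in every dimension and volume.

## Scope

Only two observables `Re χ₀`, `Re χ₁` (not the full cone of products) — what the lattice-gauge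
applications need. Sources: Ginibre 1970, Prop. 3 / Example 4; as used for abelian lattice gauge
theories by Fröhlich–Spencer, Comm. Math. Phys. 83 (1982) 411 (§2) and Forsström–Lenells–Viklund,
AIHP 2022, Lemma 4.2.
-/

noncomputable section

open MeasureTheory Filter Finset
open scoped Topology BigOperators

namespace Literature.Probability.LatticeModels

section Model

variable {Ω : Type*} [CommGroup Ω] [TopologicalSpace Ω] {ι : Type*} [Fintype ι]

/-- The COVARIANCE INTEGRAND `4 Im χ₀(φ)Im χ₀(ψ) Im χ₁(φ)Im χ₁(ψ) exp C(φ,ψ)`, `C = ∑ γₐ Re χₐ(φ)Re χₐ(ψ)`: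
the pull-back under duplication of `(f − f')(g − g') e^{H + H'}` (`ginibre_cov_key`).
[cite: Ginibre1970, Prop. 3 with Example 4 (compact abelian groups)] -/
def ginibreCovIntegrand (χ : ι → Ω →ₜ* Circle) (χ₀ χ₁ : Ω →ₜ* Circle) (γ : ι → ℝ) (p : Ω × Ω) : ℝ :=
  4 * (imChar χ₀ p.1 * imChar χ₀ p.2) * ((imChar χ₁ p.1 * imChar χ₁ p.2) *
    Real.exp (reKernel χ γ p))

/-- Truncations of the covariance integrand (power series of `exp` cut at `N`); each is a positive
kernel. [cite: Ginibre1970, Prop. 3 with Example 4 (compact abelian groups)] -/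
def ginibreCovTrunc (χ : ι → Ω →ₜ* Circle) (χ₀ χ₁ : Ω →ₜ* Circle) (γ : ι → ℝ) (N : ℕ)
    (p : Ω × Ω) : ℝ :=
  4 * (imChar χ₀ p.1 * imChar χ₀ p.2) * ((imChar χ₁ p.1 * imChar χ₁ p.2) *
    expTrunc N (reKernel χ γ p))

/-- Uniform bound `|trunc_N| ≤ 4 exp(∑ γₐ)` for `γ ≥ 0`. [folklore] -/
private theorem abs_ginibreCovTrunc_le (χ : ι → Ω →ₜ* Circle) (χ₀ χ₁ : Ω →ₜ* Circle) {γ : ι → ℝ}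
    (hγ : ∀ a, 0 ≤ γ a) (N : ℕ) (p : Ω × Ω) :
    |ginibreCovTrunc χ χ₀ χ₁ γ N p| ≤ 4 * Real.exp (∑ a, γ a) := by
  unfold ginibreCovTrunc
  have a1 := abs_imChar_le_one χ₀ p.1
  have a2 := abs_imChar_le_one χ₀ p.2
  have a3 := abs_imChar_le_one χ₁ p.1
  have a4 := abs_imChar_le_one χ₁ p.2
  have hE : |expTrunc N (reKernel χ γ p)| ≤ Real.exp (∑ a, γ a) :=
    abs_expTrunc_le (abs_reKernel_le χ hγ p) N
  simp only [abs_mul, abs_of_pos (by norm_num : (0 : ℝ) < 4)]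
  have h : |imChar χ₀ p.1| * |imChar χ₀ p.2| *
      (|imChar χ₁ p.1| * |imChar χ₁ p.2| * |expTrunc N (reKernel χ γ p)|) ≤
      1 * 1 * (1 * 1 * Real.exp (∑ a, γ a)) := by
    gcongr
  linarith

/-- The truncations converge to the integrand. [folklore] -/
private theorem tendsto_ginibreCovTrunc (χ : ι → Ω →ₜ* Circle) (χ₀ χ₁ : Ω →ₜ* Circle) (γ : ι → ℝ)
    (p : Ω × Ω) :
    Tendsto (fun N => ginibreCovTrunc χ χ₀ χ₁ γ N p) atTop (𝓝 (ginibreCovIntegrand χ χ₀ χ₁ γ p)) := by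
  unfold ginibreCovTrunc ginibreCovIntegrand
  exact ((tendsto_expTrunc _).const_mul _).const_mul _

/-- Each truncation is a positive kernel (`γ ≥ 0`). [folklore] -/
private theorem isPosKernel_ginibreCovTrunc (χ : ι → Ω →ₜ* Circle) (χ₀ χ₁ : Ω →ₜ* Circle) {γ : ι → ℝ}
    (hγ : ∀ a, 0 ≤ γ a) (N : ℕ) : IsPosKernel (ginibreCovTrunc χ χ₀ χ₁ γ N) :=
  ((isPosKernel_mul_self (continuous_imChar χ₀)).const_mul (by norm_num : (0 : ℝ) ≤ 4)).mul
    ((isPosKernel_mul_self (continuous_imChar χ₁)).mul ((isPosKernel_reKernel χ hγ).comp_expTrunc N))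

/-- **The key pointwise identity**: with `H = ∑ Jₐ Re χₐ`, `f = Re χ₀`, `g = Re χ₁`, `θ = φψ`,
`θ' = φψ⁻¹`: `(f(θ) − f(θ'))(g(θ) − g(θ')) e^{H(θ)} e^{H(θ')} = 4 Im χ₀(φ)Im χ₀(ψ) Im χ₁(φ)Im χ₁(ψ) e^{C}`,
`C = 2∑ Jₐ Re χₐ(φ)Re χₐ(ψ)`. [cite: Ginibre1970, Prop. 3 with Example 4 (compact abelian groups)] -/
theorem ginibre_cov_key (χ : ι → Ω →ₜ* Circle) (χ₀ χ₁ : Ω →ₜ* Circle) (J : ι → ℝ) (φ ψ : Ω) :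
    (reChar χ₀ (φ * ψ) - reChar χ₀ (φ * ψ⁻¹)) * (reChar χ₁ (φ * ψ) - reChar χ₁ (φ * ψ⁻¹)) *
        (ginibreWeight χ J (φ * ψ) * ginibreWeight χ J (φ * ψ⁻¹)) =
      ginibreCovIntegrand χ χ₀ χ₁ (fun a => 2 * J a) (φ, ψ) := by
  have h3 := ginibreHamiltonian_mul_add χ J φ ψ
  have hf := reChar_mul_sub_reChar_mul_inv χ₀ φ ψ
  have hg := reChar_mul_sub_reChar_mul_inv χ₁ φ ψ
  have hγ : reKernel χ (fun a => 2 * J a) (φ, ψ) = 2 * ∑ a, J a * (reChar (χ a) φ * reChar (χ a) ψ) := by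
    simp only [reKernel, Finset.mul_sum]
    exact Finset.sum_congr rfl fun a _ => by ring
  have hxy : ginibreWeight χ J (φ * ψ) * ginibreWeight χ J (φ * ψ⁻¹) =
      Real.exp (2 * ∑ a, J a * (reChar (χ a) φ * reChar (χ a) ψ)) := by
    rw [ginibreWeight, ginibreWeight, ← Real.exp_add, h3]
  simp only [ginibreCovIntegrand]
  rw [hγ, hf, hg, hxy]
  ring

variable [CompactSpace Ω] [SecondCountableTopology Ω] [MeasurableSpace Ω] [BorelSpace Ω]

/-- **Positivity of the covariance integral**: `∫∫ 4 Im χ₀ Im χ₀ · Im χ₁ Im χ₁ · exp C d(μ ⊗ μ) ≥ 0`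
for `γ ≥ 0` and any finite measure — limit of integrals of positive kernels.
[cite: Ginibre1970, Prop. 3 with Example 4 (compact abelian groups)] -/
theorem integral_ginibreCovIntegrand_nonneg (μ : Measure Ω) [IsFiniteMeasure μ]
    (χ : ι → Ω →ₜ* Circle) (χ₀ χ₁ : Ω →ₜ* Circle) {γ : ι → ℝ} (hγ : ∀ a, 0 ≤ γ a) :
    0 ≤ ∫ p, ginibreCovIntegrand χ χ₀ χ₁ γ p ∂(μ.prod μ) := by
  have hlim : Tendsto (fun N => ∫ p, ginibreCovTrunc χ χ₀ χ₁ γ N p ∂(μ.prod μ)) atTop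
      (𝓝 (∫ p, ginibreCovIntegrand χ χ₀ χ₁ γ p ∂(μ.prod μ))) := by
    refine tendsto_integral_of_dominated_convergence (fun _ => 4 * Real.exp (∑ a, γ a)) ?_
      (integrable_const _) ?_ ?_
    · exact fun N => (isPosKernel_ginibreCovTrunc χ χ₀ χ₁ hγ N).continuous.aestronglyMeasurable
    · exact fun N => ae_of_all _ fun p => by
        rw [Real.norm_eq_abs]; exact abs_ginibreCovTrunc_le χ χ₀ χ₁ hγ N p
    · exact ae_of_all _ fun p => tendsto_ginibreCovTrunc χ χ₀ χ₁ γ p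
  exact ge_of_tendsto' hlim fun N => (isPosKernel_ginibreCovTrunc χ χ₀ χ₁ hγ N).integral_nonneg μ

end Model

/-! ### The covariance inequality -/

section Haar

variable {Ω : Type*} [CommGroup Ω] [TopologicalSpace Ω] [IsTopologicalGroup Ω] [CompactSpace Ω]
  [SecondCountableTopology Ω] [MeasurableSpace Ω] [BorelSpace Ω] {ι : Type*} [Fintype ι]

/-- **GINIBRE'S INEQUALITY, COVARIANCE FORM (Griffiths' second inequality for compact abelian
models).**  Let `Ω` be a compact second-countable abelian group in which every element is a square,
`μ` a Haar probability measure, `χₐ, χ₀, χ₁` continuous unitary characters, `Jₐ ≥ 0`.  Then for the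
Gibbs state of `−H = ∑ Jₐ Re χₐ`: `⟨Re χ₀⟩ ⟨Re χ₁⟩ ≤ ⟨Re χ₀ · Re χ₁⟩`
(`2 Z² (⟨fg⟩ − ⟨f⟩⟨g⟩) = ∫∫ (f − f')(g − g') e^{H+H'} ≥ 0` by duplication and positivity).
[cite: Ginibre1970, Prop. 3 with Example 4 (compact abelian groups)] -/
theorem ginibreExpect_mul_reChar_ge (μ : Measure Ω) [μ.IsHaarMeasure] [IsProbabilityMeasure μ]
    (h2 : Function.Surjective fun ψ : Ω => ψ * ψ) (χ : ι → Ω →ₜ* Circle) (χ₀ χ₁ : Ω →ₜ* Circle)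
    {J : ι → ℝ} (hJ : ∀ a, 0 ≤ J a) :
    ginibreExpect μ χ J (reChar χ₀) * ginibreExpect μ χ J (reChar χ₁) ≤
      ginibreExpect μ χ J (fun θ => reChar χ₀ θ * reChar χ₁ θ) := by
  have hfc := continuous_reChar χ₀
  have hgc := continuous_reChar χ₁
  have hwc := continuous_ginibreWeight χ J
  have hZ : 0 < ∫ θ, ginibreWeight χ J θ ∂μ :=
    integral_exp_pos (integrable_of_continuous_compactSpace μ hwc)
  unfold ginibreExpect
  rw [div_mul_div_comm, div_le_div_iff₀ (mul_pos hZ hZ) hZ]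
  -- the duplicated difference is the integral of the (non-negative) covariance integrand
  have hdup := integral_sub_mul_sub_mul μ hfc hgc hwc
  have hcont : Continuous fun p : Ω × Ω =>
      (reChar χ₀ p.1 - reChar χ₀ p.2) * (reChar χ₁ p.1 - reChar χ₁ p.2) *
        (ginibreWeight χ J p.1 * ginibreWeight χ J p.2) := by fun_prop
  have hcv : ∫ p : Ω × Ω, (reChar χ₀ (p.1 * p.2) - reChar χ₀ (p.1 * p.2⁻¹)) *
        (reChar χ₁ (p.1 * p.2) - reChar χ₁ (p.1 * p.2⁻¹)) *
        (ginibreWeight χ J (p.1 * p.2) * ginibreWeight χ J (p.1 * p.2⁻¹)) ∂(μ.prod μ) =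
      ∫ p : Ω × Ω, (reChar χ₀ p.1 - reChar χ₀ p.2) * (reChar χ₁ p.1 - reChar χ₁ p.2) *
        (ginibreWeight χ J p.1 * ginibreWeight χ J p.2) ∂(μ.prod μ) := by
    simpa only [dupHom_apply] using integral_comp_dupHom μ h2 hcont
  have hI : ∫ p : Ω × Ω, (reChar χ₀ (p.1 * p.2) - reChar χ₀ (p.1 * p.2⁻¹)) *
        (reChar χ₁ (p.1 * p.2) - reChar χ₁ (p.1 * p.2⁻¹)) *
        (ginibreWeight χ J (p.1 * p.2) * ginibreWeight χ J (p.1 * p.2⁻¹)) ∂(μ.prod μ) =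
      ∫ p, ginibreCovIntegrand χ χ₀ χ₁ (fun a => 2 * J a) p ∂(μ.prod μ) :=
    integral_congr_ae (ae_of_all _ fun p => ginibre_cov_key χ χ₀ χ₁ J p.1 p.2)
  have hpos := integral_ginibreCovIntegrand_nonneg μ χ χ₀ χ₁ (γ := fun a => 2 * J a)
    (fun a => by have := hJ a; positivity)
  rw [← hI, hcv, hdup] at hpos
  -- `hpos : 0 ≤ 2 ((∫ f w g) Z − (∫ f w)(∫ w g))`
  have e1 : ∫ x, reChar χ₀ x * (ginibreWeight χ J x * reChar χ₁ x) ∂μ =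
      ∫ x, reChar χ₀ x * reChar χ₁ x * ginibreWeight χ J x ∂μ :=
    integral_congr_ae (ae_of_all _ fun x => by ring)
  have e2 : ∫ x, ginibreWeight χ J x * reChar χ₁ x ∂μ = ∫ x, reChar χ₁ x * ginibreWeight χ J x ∂μ :=
    integral_congr_ae (ae_of_all _ fun x => by ring)
  rw [e1, e2] at hpos
  nlinarith [hpos]

end Haar

end Literature.Probability.LatticeModels
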